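import Mathlib
import Summits.Ventures.PercRepro2.V2SP
import Summits.Ventures.PercRepro2.Tail2DP2SeriesSP
import Summits.Ventures.PercRepro2.Tail2DOffAxis31
import Summits.Ventures.PercRepro2.Tail2DStepCert
import Summits.Ventures.PercRepro2.Tail2DUnitStep
import Summits.Ventures.PercRepro2.Tail2DPathFlip
import Summits.Ventures.PercRepro2.Tail2DPathAvg

/-!
# The anti-diagonal unimodality of the tails reduces to the parallel step of the tail-average monotonicity
(pin-free patterns; seat mine-b, cell pub-perc-repro2; MINE-B.md §39.14)

Let `T(a,c) = #{r ≥ a ∧ b ≥ c}` and `P(a,c) = Σ_{r ≥ a ∧ b ≥ c} #bluePaths(x)` (the blue paths of the tail set).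
The flip bijection of `Tail2DPathFlip.lean`, restricted to tail sets, and the colour swap give the exact
REFLECTION IDENTITY `P(a,c) = P(c−1, a+1)` (`tailPaths_reflect`, `c ≥ 1`).  The TAIL-AVERAGE MONOTONICITY
`(T-AVG)(a,c)`: `P(a,c)·T(a−1,c+1) ≤ P(a−1,c+1)·T(a,c)` (`TailAvg`; the average number of blue paths over the
tail set does not decrease when the tail moves one step bluer).  Its SERIES step is trivial — tail sets of a series
composition are products of the factors' tail sets and blue paths multiply, so both `T` and `P` multiply
(`tailAvg_ser`).  Iterating (T-AVG) from `(c−1, a+1)` to `(a, c)` along the anti-diagonal and using the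
reflection identity gives `T(a,c) ≤ T(c−1,a+1) = T(a+1,c−1)` for `a + 1 ≤ c` (`offaxis_of_tailAvg`): on a
pin-free pattern the WHOLE anti-diagonal unimodality of the tails — every member `T(a,j) ≤ T(a−1,j+1)`,
`j ≤ a−2`, including the lane's open members `(7,5), (8,5), …` — follows from (T-AVG) at every tail point, and
(T-AVG) holds on every pin-free pattern as soon as its PARALLEL step does (`tailAvg_all_of_par`,
`offaxis_all_of_par'`).  The parallel step is the open item (census: 0 violations on every pin-free pattern
≤ 11 edges, §39.13–39.14).
-/

namespace Summit.Ventures.PercRepro2.Tail2D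

open V2Closure

section Defs

variable (s : V2Closure.SP)

/-- the tail count `T(a,c) = #{r ≥ a ∧ b ≥ c}` -/
def tailCount (a c : ℕ) : ℕ := (Finset.univ.filter (fun x : s.Conf => a ≤ s.rLab x ∧ c ≤ s.bLab x)).card

/-- the blue paths of the tail set: `P(a,c) = Σ_{r ≥ a ∧ b ≥ c} #bluePaths` -/
def tailPaths (a c : ℕ) : ℕ :=
  ∑ x ∈ Finset.univ.filter (fun x : s.Conf => a ≤ s.rLab x ∧ c ≤ s.bLab x), Fintype.card (bluePaths s x)

/-- **tail-average monotonicity** `(T-AVG)(a,c)`: `P(a,c)·T(a−1,c+1) ≤ P(a−1,c+1)·T(a,c)` — the average number of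
blue paths over the tail set does not decrease when the tail moves one step bluer -/
def TailAvg (a c : ℕ) : Prop :=
  tailPaths s a c * tailCount s (a - 1) (c + 1) ≤ tailPaths s (a - 1) (c + 1) * tailCount s a c

/-- the flip bijection restricted to tail sets: the blue paths of `T(a,c)` are as many as the red paths of
`T(a+1, c−1)` (`c ≥ 1`) -/
theorem tailPaths_eq_red (a c : ℕ) (hc : 1 ≤ c) :
    tailPaths s a c
      = ∑ x ∈ Finset.univ.filter (fun x : s.Conf => a + 1 ≤ s.rLab x ∧ c - 1 ≤ s.bLab x), Fintype.card (redPaths s x) := by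
  unfold tailPaths
  rw [Finset.sum_subtype (Finset.univ.filter (fun x : s.Conf => a ≤ s.rLab x ∧ c ≤ s.bLab x))
      (p := fun x : s.Conf => a ≤ s.rLab x ∧ c ≤ s.bLab x) (fun x => by simp),
    Finset.sum_subtype (Finset.univ.filter (fun x : s.Conf => a + 1 ≤ s.rLab x ∧ c - 1 ≤ s.bLab x))
      (p := fun x : s.Conf => a + 1 ≤ s.rLab x ∧ c - 1 ≤ s.bLab x) (fun x => by simp),
    ← Fintype.card_sigma, ← Fintype.card_sigma]
  refine Fintype.card_congr ?_
  refine (Equiv.subtypeSigmaEquiv _ _).symm.trans ?_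
  refine Equiv.trans ?_ (Equiv.subtypeSigmaEquiv _ _)
  refine Equiv.subtypeEquiv (flipEquiv s) (fun y => ?_)
  simp only [flipEquiv, Equiv.coe_fn_mk]
  rw [rLab_flipB, ← bLab_flipB s y.1 y.2]
  omega

/-- the red paths of a tail set are the blue paths of the mirrored tail set (the colour swap) -/
theorem tailPaths_red_swap (a c : ℕ) :
    (∑ x ∈ Finset.univ.filter (fun x : s.Conf => a ≤ s.rLab x ∧ c ≤ s.bLab x), Fintype.card (redPaths s x))
      = tailPaths s c a := by
  unfold tailPaths
  refine Finset.sum_nbij' (swapConf s) (swapConf s) ?_ ?_ ?_ ?_ ?_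
  · intro x hx; simp only [Finset.mem_filter, Finset.mem_univ, true_and, rLab_swapConf, bLab_swapConf] at hx ⊢; exact ⟨hx.2, hx.1⟩
  · intro x hx; simp only [Finset.mem_filter, Finset.mem_univ, true_and, rLab_swapConf, bLab_swapConf] at hx ⊢; exact ⟨hx.2, hx.1⟩
  · intro x _; exact swapConf_swapConf s x
  · intro x _; exact swapConf_swapConf s x
  · intro x _
    have := card_redPaths_swap s (swapConf s x)
    rw [swapConf_swapConf] at this
    exact this

/-- **the reflection identity** `P(a,c) = P(c−1, a+1)` for `c ≥ 1` -/
theorem tailPaths_reflect (a c : ℕ) (hc : 1 ≤ c) : tailPaths s a c = tailPaths s (c - 1) (a + 1) := by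
  rw [tailPaths_eq_red s a c hc, tailPaths_red_swap]

/-- `T(a,c) = T(c,a)` in the `tailCount` vocabulary -/
theorem tailCount_symm (a c : ℕ) : tailCount s a c = tailCount s c a := tail_symm s a c

end Defs

section Series

variable (s t : V2Closure.SP)

/-- the blue paths of a series composition are pairs of paths -/
theorem card_bluePaths_ser (p : (V2Closure.SP.ser s t).Conf) :
    Fintype.card (bluePaths (V2Closure.SP.ser s t) p) = Fintype.card (bluePaths s p.1) * Fintype.card (bluePaths t p.2) := by
  show Fintype.card (bluePaths s p.1 × bluePaths t p.2) = _
  rw [Fintype.card_prod]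

/-- the tail count of a series composition multiplies -/
theorem tailCount_ser (a c : ℕ) : tailCount (V2Closure.SP.ser s t) a c = tailCount s a c * tailCount t a c :=
  card_tail_ser s t a c

/-- the tail paths of a series composition multiply -/
theorem tailPaths_ser (a c : ℕ) : tailPaths (V2Closure.SP.ser s t) a c = tailPaths s a c * tailPaths t a c := by
  unfold tailPaths
  rw [Finset.sum_filter, Finset.sum_filter, Finset.sum_filter,
    ← sum_prod_mul s t (fun x => if a ≤ s.rLab x ∧ c ≤ s.bLab x then Fintype.card (bluePaths s x) else 0)
      (fun y => if a ≤ t.rLab y ∧ c ≤ t.bLab y then Fintype.card (bluePaths t y) else 0)]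
  refine Finset.sum_congr rfl (fun p _ => ?_)
  rw [card_bluePaths_ser]
  simp only [SP.rLab, SP.bLab, serR, serB]
  split_ifs <;> omega

/-- **the series step of (T-AVG)** (trivial: both `T` and `P` multiply) -/
theorem tailAvg_ser (a c : ℕ) (hs : TailAvg s a c) (ht : TailAvg t a c) : TailAvg (V2Closure.SP.ser s t) a c := by
  unfold TailAvg at *
  rw [tailPaths_ser, tailPaths_ser, tailCount_ser, tailCount_ser]
  calc tailPaths s a c * tailPaths t a c * (tailCount s (a - 1) (c + 1) * tailCount t (a - 1) (c + 1))
      = (tailPaths s a c * tailCount s (a - 1) (c + 1)) * (tailPaths t a c * tailCount t (a - 1) (c + 1)) := by ring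
    _ ≤ (tailPaths s (a - 1) (c + 1) * tailCount s a c) * (tailPaths t (a - 1) (c + 1) * tailCount t a c) :=
        Nat.mul_le_mul hs ht
    _ = tailPaths s (a - 1) (c + 1) * tailPaths t (a - 1) (c + 1) * (tailCount s a c * tailCount t a c) := by ring

end Series

section Reduction

/-- on a pin-free pattern a configuration with red flow `≥ 1` has a red path -/
theorem exists_redPath {s : V2Closure.SP} (hs : PinFree s) (x : s.Conf) (hx : 1 ≤ s.rLab x) : Nonempty (redPaths s x) := by
  have h := exists_bluePath hs (swapConf s x) (by rw [bLab_swapConf]; exact hx)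
  rw [← Fintype.card_pos_iff] at h ⊢
  rw [← card_redPaths_swap s (swapConf s x), swapConf_swapConf] at h
  exact h

/-- the attainable tails move bluer: `T(a,c) > 0 → T(a−1,c+1) > 0` for `a ≥ 1` (flip a red path) -/
theorem tailCount_pos_bluer {s : V2Closure.SP} (hs : PinFree s) (a c : ℕ) (ha : 1 ≤ a)
    (h : 0 < tailCount s a c) : 0 < tailCount s (a - 1) (c + 1) := by
  unfold tailCount at *
  rw [Finset.card_pos] at h ⊢
  obtain ⟨x, hx⟩ := h
  simp only [Finset.mem_filter, Finset.mem_univ, true_and] at hx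
  obtain ⟨q⟩ := exists_redPath hs x (by omega)
  refine ⟨flipR s x q, ?_⟩
  simp only [Finset.mem_filter, Finset.mem_univ, true_and]
  have h1 := rLab_flipB s (flipR s x q) (toBlue s x q)
  have h2 := bLab_flipB s (flipR s x q) (toBlue s x q)
  rw [flipB_flipR] at h1 h2
  omega

/-- every tail set with `c ≥ 1` and a configuration carries a blue path (pin-free): `T(a,c) ≤ P(a,c)` -/
theorem tailCount_le_tailPaths {s : V2Closure.SP} (hs : PinFree s) (a c : ℕ) (hc : 1 ≤ c) :
    tailCount s a c ≤ tailPaths s a c := by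
  unfold tailCount tailPaths
  rw [Finset.card_eq_sum_ones]
  refine Finset.sum_le_sum (fun x hx => ?_)
  simp only [Finset.mem_filter, Finset.mem_univ, true_and] at hx
  have := exists_bluePath hs x (by omega)
  exact Fintype.card_pos

/-- the chain of (T-AVG) steps along an anti-diagonal: `P(a+k, c)·T(a, c+k) ≤ P(a, c+k)·T(a+k, c)` whenever the
redder tail `T(a+k, c)` is non-empty (all intermediate tails are then non-empty) -/
theorem tailAvg_chain {s : V2Closure.SP} (hs : PinFree s) (h : ∀ a c, 1 ≤ a → TailAvg s a c) :
    ∀ (k a c : ℕ), 0 < tailCount s (a + k) c →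
      tailPaths s (a + k) c * tailCount s a (c + k) ≤ tailPaths s a (c + k) * tailCount s (a + k) c
  | 0, a, c, _ => by simp
  | k + 1, a, c, hpos => by
    -- one step from `(a+k+1, c)` to `(a+k, c+1)`, then the chain of `k` steps from `(a+k, c+1)` to `(a, c+k+1)`
    have step := h (a + k + 1) c (by omega)
    unfold TailAvg at step
    rw [show a + k + 1 - 1 = a + k by omega] at step
    have hpos' : 0 < tailCount s (a + k) (c + 1) := by
      have := tailCount_pos_bluer hs (a + k + 1) c (by omega) hpos
      rwa [show a + k + 1 - 1 = a + k by omega] at this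
    have chain := tailAvg_chain hs h k a (c + 1) hpos'
    rw [show c + 1 + k = c + (k + 1) by omega] at chain
    -- multiply: P(a+k+1,c)·T(a+k,c+1) ≤ P(a+k,c+1)·T(a+k+1,c) and P(a+k,c+1)·T(a,c+k+1) ≤ P(a,c+k+1)·T(a+k,c+1)
    have hmul := Nat.mul_le_mul step chain
    -- cancel the positive factor `P(a+k,c+1)·T(a+k,c+1)`; if `P(a+k,c+1) = 0` both sides of the goal vanish
    rcases Nat.eq_zero_or_pos (tailPaths s (a + k) (c + 1)) with hP | hP
    · -- `P(a+k, c+1) = 0` forces `T(a+k, c+1) = 0` (`c+1 ≥ 1`), contradicting `hpos'`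
      have := tailCount_le_tailPaths hs (a + k) (c + 1) (by omega)
      omega
    · have hprod : 0 < tailPaths s (a + k) (c + 1) * tailCount s (a + k) (c + 1) := Nat.mul_pos hP hpos'
      refine Nat.le_of_mul_le_mul_left ?_ hprod
      calc tailPaths s (a + k) (c + 1) * tailCount s (a + k) (c + 1)
            * (tailPaths s (a + k + 1) c * tailCount s a (c + (k + 1)))
          = (tailPaths s (a + k + 1) c * tailCount s (a + k) (c + 1))
              * (tailPaths s (a + k) (c + 1) * tailCount s a (c + (k + 1))) := by ring
        _ ≤ (tailPaths s (a + k) (c + 1) * tailCount s (a + k + 1) c)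
              * (tailPaths s a (c + (k + 1)) * tailCount s (a + k) (c + 1)) := hmul
        _ = tailPaths s (a + k) (c + 1) * tailCount s (a + k) (c + 1)
              * (tailPaths s a (c + (k + 1)) * tailCount s (a + k + 1) c) := by ring

/-- **the anti-diagonal unimodality of the tails from (T-AVG)** (pin-free): `T(a,c) ≤ T(a+1,c−1)` for `a+1 ≤ c`
— the reflection identity `P(a,c) = P(c−1,a+1)` and the chain of (T-AVG) steps from `(c−1,a+1)` to `(a,c)` -/
theorem offaxis_of_tailAvg {s : V2Closure.SP} (hs : PinFree s) (h : ∀ a c, 1 ≤ a → TailAvg s a c) (a c : ℕ)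
    (hac : a + 1 ≤ c) : tailCount s a c ≤ tailCount s (a + 1) (c - 1) := by
  rcases Nat.eq_zero_or_pos (tailCount s (c - 1) (a + 1)) with h0 | hpos
  · -- the redder tail is empty: then so is `T(a,c)` (iterate `tailCount_pos_bluer` backwards) — argue directly:
    -- `T(a,c) > 0` would give, by `c−1−a` bluer steps from `(c−1, a+1)`… we use the contrapositive chain on `(a,c)`:
    -- `T(a,c)` is the bluer end; so instead show `T(a,c) = 0` via the chain from `(c−1,a+1)`: empty redder tail
    -- does not force an empty bluer tail.  Use the reflection identity: `P(a,c) = P(c−1,a+1) ≤ ...`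
    have hP : tailPaths s (c - 1) (a + 1) = 0 := by
      unfold tailPaths tailCount at *
      rw [Finset.card_eq_zero] at h0
      rw [h0]; simp
    have hPac : tailPaths s a c = 0 := by rw [tailPaths_reflect s a c (by omega), hP]
    have := tailCount_le_tailPaths hs a c (by omega)
    rw [tailCount_symm s (a + 1) (c - 1)]
    omega
  · have chain := tailAvg_chain hs h (c - 1 - a) a (a + 1)
      (by rw [show a + (c - 1 - a) = c - 1 by omega]; exact hpos)
    rw [show a + (c - 1 - a) = c - 1 by omega, show a + 1 + (c - 1 - a) = c by omega] at chain
    -- chain : P(c−1, a+1)·T(a, c) ≤ P(a, c)·T(c−1, a+1); with P(a,c) = P(c−1,a+1) cancel (positive since T(c−1,a+1) > 0)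
    rw [← tailPaths_reflect s a c (by omega)] at chain
    have hPpos : 0 < tailPaths s a c := by
      have h1 := tailCount_le_tailPaths hs (c - 1) (a + 1) (by omega)
      rw [← tailPaths_reflect s a c (by omega)] at h1
      omega
    rw [tailCount_symm s (a + 1) (c - 1)]
    exact Nat.le_of_mul_le_mul_left chain hPpos

/-- **the reduction of (T-AVG) on every pin-free pattern to its parallel step** -/
theorem tailAvg_all_of_par
    (hpar : ∀ s t : V2Closure.SP, PinFree s → PinFree t → (∀ a c, 1 ≤ a → TailAvg s a c) → (∀ a c, 1 ≤ a → TailAvg t a c) →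
      ∀ a c, 1 ≤ a → TailAvg (V2Closure.SP.par s t) a c) :
    ∀ {s : V2Closure.SP}, PinFree s → ∀ a c, 1 ≤ a → TailAvg s a c
  | .free, _, a, c, ha => by
    -- flows `≤ 1`: for `a ≥ 2` the tail `T(a,c)` is empty and `P(a,c) = 0`; for `a = 1` compute
    unfold TailAvg tailPaths tailCount
    rcases (by omega : a = 1 ∨ 2 ≤ a) with rfl | h2
    · rcases (by omega : c = 0 ∨ 1 ≤ c) with rfl | hc
      · decide
      · -- `T(1,c) = 0` for `c ≥ 1` (a free edge cannot carry both flows)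
        have e : (Finset.univ.filter (fun x : SP.free.Conf => 1 ≤ SP.free.rLab x ∧ c ≤ SP.free.bLab x)) = ∅ := by
          rw [Finset.filter_eq_empty_iff]
          intro x _
          cases x
          · simp [SP.rLab, SP.bLab]; omega
          · simp [SP.rLab, SP.bLab]
        rw [e]; simp
    · have e : (Finset.univ.filter (fun x : SP.free.Conf => a ≤ SP.free.rLab x ∧ c ≤ SP.free.bLab x)) = ∅ := by
        ext x; cases x <;> simp [SP.rLab, SP.bLab] <;> omega
      rw [e]; simp
  | .absent, _, a, c, ha => by
    unfold TailAvg tailPaths tailCount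
    have e : (Finset.univ.filter (fun x : SP.absent.Conf => a ≤ SP.absent.rLab x ∧ c ≤ SP.absent.bLab x)) = ∅ := by
      rw [Finset.filter_eq_empty_iff]
      intro x _
      simp only [SP.rLab, SP.bLab]
      omega
    rw [e]; simp
  | .ser s t, .ser hs ht, a, c, ha =>
    tailAvg_ser s t a c (tailAvg_all_of_par hpar hs a c ha) (tailAvg_all_of_par hpar ht a c ha)
  | .par s t, .par hs ht, a, c, ha =>
    hpar s t hs ht (fun a' c' h' => tailAvg_all_of_par hpar hs a' c' h') (fun a' c' h' => tailAvg_all_of_par hpar ht a' c' h') a c ha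

/-- **under the parallel step of (T-AVG): the whole anti-diagonal unimodality of the tails on every pin-free
pattern** — `T(a,j) ≤ T(a−1,j+1)` for `j + 2 ≤ a` (every member, including the lane's open column `j = 5`) -/
theorem offaxis_all_of_par'
    (hpar : ∀ s t : V2Closure.SP, PinFree s → PinFree t → (∀ a c, 1 ≤ a → TailAvg s a c) → (∀ a c, 1 ≤ a → TailAvg t a c) →
      ∀ a c, 1 ≤ a → TailAvg (V2Closure.SP.par s t) a c)
    {s : V2Closure.SP} (hs : PinFree s) (a j : ℕ) (hja : j + 2 ≤ a) :
    (Finset.univ.filter (fun x : s.Conf => a ≤ s.rLab x ∧ j ≤ s.bLab x)).card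
      ≤ (Finset.univ.filter (fun x : s.Conf => a - 1 ≤ s.rLab x ∧ j + 1 ≤ s.bLab x)).card := by
  have h := offaxis_of_tailAvg hs (tailAvg_all_of_par hpar hs) j a (by omega)
  unfold tailCount at h
  rw [tail_symm s a j, tail_symm s (a - 1) (j + 1)]
  exact h

end Reduction

end Summit.Ventures.PercRepro2.Tail2D
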